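import Summits.HubbardSuperconductivity.HubbardSuperconductivity.Theorems.AnisotropyChordTransferFibre3KTAssembly

/-!
# Route `AnisotropyChord` / H0 rotor rung: an ELEMENTARY shell coercivity bound — `Q̃(T) ≥ (1 − Δκ_E)·(ΔW)⁻¹`

The assembly `ktAssemblyAbs_holds` takes the shell coercivity `L2Quant` (LEMMA L2/κ₀ of the theory seat, constant
`ĝ₀ = (3η + m)/(3 + m)`, whose proof needs the three-magnon spectral input THEOREM G2) as a hypothesis.  This file proves an
UNCONDITIONAL, weaker coercivity with the landed tools only (memo ROTOR-THEORY-20 §284(b) run backwards): for `L ≥ 4`,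
`0 ≤ ε₁ + T`, `T < 2ε₁`, every shell vector `y`,

  `Re⟨y, R(T) y⟩ ≤ κ_E · Σ_S |y_s|²/W_s`,  `R(T) = (G^D_T)_SS`, `κ_E = 3ε₁/(2ε₁ − T)`   (**`re_Rmat_le`**),

because `⟨y, R y⟩ = ⟨Y, (H₀ − E) Y⟩` for the Dirichlet potential `Y = G_T ẑ` of the charge `ẑ = (−P⁻¹Bᴴy) ⊕ y` (vanishing on `D`,
`⟂` poles) and `⟨Y,(H₀−E)Y⟩ = Re⟨y, Y|_S⟩ ≤ (Σ|y|²/W)^½ (Σ_S W|Y|²)^½ ≤ (Σ|y|²/W)^½ (κ_E⟨Y,(H₀−E)Y⟩)^½` by `ShellDirichletBound` and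
`PoleComplementGap`.  Hence **`shell_coercive_elementary`**: `(1 − Δκ_E)·Σ_S |y_s|²/(ΔW_s) ≤ Re⟨y, Q̃(T) y⟩` — the `L2Quant` SHAPE
with `ĝ = 1 − Δκ_E`, positive for `Δ < (2ε₁ − T)/(3ε₁)` (≈ `Δ < .55`).  Used by `…Fibre3KTAssemblySmallDelta`.
Prover seat `hubbard-h0-rotor-p1` g22; helper for stmt-HubbardSuperconductivity-19089 (`--supports`).
-/

set_option linter.dupNamespace false
set_option autoImplicit false

noncomputable section

open scoped BigOperators
open Complex Matrix

namespace Summit.HubbardSuperconductivity.HubbardSuperconductivity.Theorems.AnisotropyChord.Transfer.Fibre3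

variable (L : ℕ) [NeZero L]

/-! ## Extension of a `D ⊕ S` vector to the fibre -/

/-- a `D ⊕ S` vector read on the configuration space (`0` off `D ∪ S`). [folklore] -/
def extDS (z : DS L → ℂ) : Cfg L → ℂ := fun c =>
  if h : InD L c = true then z (Sum.inl ⟨c, h⟩) else if h' : InS L c = true then z (Sum.inr ⟨c, h'⟩) else 0

omit [NeZero L] in
/-- [folklore] -/
theorem extDS_cfgOf (z : DS L → ℂ) (j : DS L) : extDS L z (cfgOf L j) = z j := by
  rcases j with d | s
  · show extDS L z d.1 = _; unfold extDS; rw [dif_pos d.2]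
  · show extDS L z s.1 = _
    have hD := InD_false_of_InS L s.2
    unfold extDS; rw [dif_neg (by simp [hD]), dif_pos s.2]

omit [NeZero L] in
/-- [folklore] -/
theorem extDS_zero (z : DS L → ℂ) (c : Cfg L) (hD : InD L c = false) (hS : InS L c = false) : extDS L z c = 0 := by
  unfold extDS; rw [dif_neg (by simp [hD]), dif_neg (by simp [hS])]

/-- `G_DS z`, read at a boundary index, is `G_T ẑ` there. [folklore] -/
theorem GDS_mulVec_eq (T : ℝ) (z : DS L → ℂ) (i : DS L) :
    (GDS L T *ᵥ z) i = Gapply L T (extDS L z) (cfgOf L i) := by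
  simp only [Matrix.mulVec, dotProduct]
  unfold GDS
  rw [← sum_Gentry_DS L T (extDS L z) (extDS_zero L z)]
  refine Finset.sum_congr rfl fun j _ => ?_
  rw [extDS_cfgOf]

/-- `⟨z, G_DS z⟩ = ⟨ẑ, G_T ẑ⟩`. [folklore] -/
theorem GDS_form_eq (T : ℝ) (z : DS L → ℂ) :
    star z ⬝ᵥ GDS L T *ᵥ z = ip L (extDS L z) (Gapply L T (extDS L z)) := by
  unfold ip
  rw [← sum_DS_eq L (fun c => (starRingEnd ℂ) (extDS L z c) * Gapply L T (extDS L z) c)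
    (fun c hD hS => by rw [extDS_zero L z c hD hS, map_zero, zero_mul])]
  simp only [dotProduct, Pi.star_apply, Complex.star_def, GDS_mulVec_eq, extDS_cfgOf]

/-! ## The Dirichlet potential of a shell vector -/

/-- the `D`-component that makes the potential vanish on `D`: `x* = −P⁻¹ Bᴴ y`. [folklore] -/
def xstar (T : ℝ) (y : Ssub L → ℂ) : Dsub L → ℂ := -((Pmat L T)⁻¹ *ᵥ (BHmat L T *ᵥ y))

/-- the charge `ẑ = x* ⊕ y` on the fibre. [folklore] -/
def zhat (T : ℝ) (y : Ssub L → ℂ) : Cfg L → ℂ := extDS L (Sum.elim (xstar L T y) y)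

/-- `⟨y, R(T) y⟩ = ⟨ẑ, G_T ẑ⟩` (the Schur complement as the value at the optimal `D`-component). [folklore] -/
theorem Rmat_form_eq (hL : 4 ≤ L) {T : ℝ} (hT : T < 2 * eps1 L) (y : Ssub L → ℂ) :
    star y ⬝ᵥ Rmat L T *ᵥ y = ip L (zhat L T y) (Gapply L T (zhat L T y)) := by
  have h := GDS_form_split L hL hT (xstar L T y) y
  have hw : xstar L T y + (Pmat L T)⁻¹ *ᵥ (BHmat L T *ᵥ y) = 0 := by unfold xstar; exact neg_add_cancel _
  rw [hw, Matrix.mulVec_zero, dotProduct_zero, zero_add] at h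
  rw [← h, GDS_form_eq]; rfl

/-- the potential `Y = G_T ẑ` vanishes on `D`. [folklore] -/
theorem Gapply_zhat_D (hL : 4 ≤ L) {T : ℝ} (hT : T < 2 * eps1 L) (y : Ssub L → ℂ) (c : Cfg L) (hc : InD L c = true) :
    Gapply L T (zhat L T y) c = 0 := by
  have h := GDS_mulVec_eq L T (Sum.elim (xstar L T y) y) (Sum.inl ⟨c, hc⟩)
  rw [GDS_eq_fromBlocks, Matrix.fromBlocks_mulVec, Sum.elim_comp_inl, Sum.elim_comp_inr, Sum.elim_inl] at h
  unfold zhat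
  rw [show (cfgOf L (Sum.inl ⟨c, hc⟩) : Cfg L) = c from rfl] at h
  rw [← h, Pi.add_apply]
  unfold xstar
  rw [Matrix.mulVec_neg, Matrix.mulVec_mulVec, Matrix.mul_nonsing_inv _ (isUnit_iff_ne_zero.mpr (det_P_ne_zero L hL hT)),
    Matrix.one_mulVec, Pi.neg_apply, neg_add_cancel]

/-- `⟨ẑ, Y⟩ = ⟨y, Y|_S⟩` since `Y` vanishes on `D` and `ẑ` vanishes off `D ∪ S`. [folklore] -/
theorem ip_zhat_eq (hL : 4 ≤ L) {T : ℝ} (hT : T < 2 * eps1 L) (y : Ssub L → ℂ) :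
    ip L (zhat L T y) (Gapply L T (zhat L T y)) = star y ⬝ᵥ (fun s : Ssub L => Gapply L T (zhat L T y) s.1) := by
  classical
  set Y := Gapply L T (zhat L T y) with hY
  unfold ip
  rw [← sum_DS_eq L (fun c => (starRingEnd ℂ) (zhat L T y c) * Y c)
    (fun c hD hS => by unfold zhat; rw [extDS_zero L _ c hD hS, map_zero, zero_mul]), Fintype.sum_sum_type]
  have hD0 : ∑ d : Dsub L, (starRingEnd ℂ) (zhat L T y (cfgOf L (Sum.inl d))) * Y (cfgOf L (Sum.inl d)) = 0 :=
    Finset.sum_eq_zero fun d _ => by rw [show (cfgOf L (Sum.inl d) : Cfg L) = d.1 from rfl, hY,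
      Gapply_zhat_D L hL hT y d.1 d.2, mul_zero]
  rw [hD0, zero_add]
  simp only [dotProduct, Pi.star_apply, Complex.star_def]
  refine Finset.sum_congr rfl fun s _ => ?_
  unfold zhat
  rw [extDS_cfgOf]; rfl

/-! ## The elementary bounds -/

/-- **`Re⟨y, R(T) y⟩ ≤ κ_E Σ_S |y_s|²/W_s`** (`0 ≤ ε₁ + T`, `T < 2ε₁`, `L ≥ 4`). [folklore] -/
theorem re_Rmat_le (hL : 4 ≤ L) {T : ℝ} (hE : 0 ≤ eps1 L + T) (hT : T < 2 * eps1 L) (y : Ssub L → ℂ) :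
    (star y ⬝ᵥ Rmat L T *ᵥ y).re ≤ (3 * eps1 L / (2 * eps1 L - T)) * ∑ s : Ssub L, ‖y s‖ ^ 2 / (Wcount L s.1 : ℝ) := by
  have hL2 : 2 ≤ L := by omega
  set Y := Gapply L T (zhat L T y) with hY
  set κ : ℝ := 3 * eps1 L / (2 * eps1 L - T) with hκ
  have hε := eps1_pos L hL
  have hκpos : 0 < κ := by rw [hκ]; apply div_pos <;> linarith
  have hY0 : ∀ c, InD L c = true → Y c = 0 := fun c hc => Gapply_zhat_D L hL hT y c hc
  have horth : ∀ j : Fin 3, ip L (poleWave L j) Y = 0 := fun j => ip_poleWave_Gapply L T _ j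
  -- q = Re⟨y, R y⟩ = Re⟨ẑ, Y⟩ = Re⟨Y, (H₀ − E) Y⟩
  set q : ℝ := (star y ⬝ᵥ Rmat L T *ᵥ y).re with hq
  have hq1 : q = (star y ⬝ᵥ (fun s : Ssub L => Y s.1)).re := by
    rw [hq, Rmat_form_eq L hL hT, ip_zhat_eq L hL hT]
  have hq2 : q = (ip L Y (H0apply L (K1 L) Y)).re - (eps1 L + T) * (ip L Y Y).re := by
    have e1 : ip L Y (fun c => H0apply L (K1 L) Y c - ((eps1 L + T : ℝ) : ℂ) * Y c) = ip L Y (zhat L T y) := by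
      have hpt : (fun c => H0apply L (K1 L) Y c - ((eps1 L + T : ℝ) : ℂ) * Y c)
          = fun c => zhat L T y c - PiPole L (zhat L T y) c := by
        funext c; rw [hY, H0E_Gapply L hL hT]
      rw [hpt, ip_sub_right, ip_PiPole_of_orth L hL2 horth, sub_zero]
    have e2 : (ip L Y (zhat L T y)).re = (ip L (zhat L T y) Y).re := by
      rw [← conj_ip, Complex.conj_re]
    rw [hq, Rmat_form_eq L hL hT, ← hY, ← e2, ← e1, ip_sub_right, Complex.sub_re]
    congr 1
    have : ip L Y (fun c => ((eps1 L + T : ℝ) : ℂ) * Y c) = ((eps1 L + T : ℝ) : ℂ) * ip L Y Y := by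
      unfold ip; rw [Finset.mul_sum]; refine Finset.sum_congr rfl fun c _ => ?_; ring
    rw [this, Complex.re_ofReal_mul]
  -- the shell mass of Y is controlled by κ q
  have hmass : ∑ s : Ssub L, (Wcount L s.1 : ℝ) * ‖Y s.1‖ ^ 2 ≤ κ * q := by
    have h1 := sum_Ssub_le L (fun c => (Wcount L c : ℝ) * ‖Y c‖ ^ 2) (fun c => by positivity)
    have h2 := shellDirichletBound_holds L Y hY0
    have h3 := re_H0_le_kappa L hL hT hE Y horth
    rw [← hq2] at h3
    linarith
  -- Cauchy–Schwarz in weighted form: q ≤ (t/2) A + (1/2t) κ q with t = κ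
  set A : ℝ := ∑ s : Ssub L, ‖y s‖ ^ 2 / (Wcount L s.1 : ℝ) with hA
  have hW : ∀ s : Ssub L, (0 : ℝ) < Wcount L s.1 := fun s => by exact_mod_cast Wcount_pos_of_InS L s.2
  have hpt : ∀ s : Ssub L, ‖y s‖ * ‖Y s.1‖ ≤ (κ * (‖y s‖ ^ 2 / (Wcount L s.1 : ℝ)) + (Wcount L s.1 : ℝ) * ‖Y s.1‖ ^ 2 / κ) / 2 := by
    intro s
    have hω := hW s
    have key : 2 * (‖y s‖ * ‖Y s.1‖) * (κ * (Wcount L s.1 : ℝ))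
        ≤ κ ^ 2 * ‖y s‖ ^ 2 + (Wcount L s.1 : ℝ) ^ 2 * ‖Y s.1‖ ^ 2 := by
      nlinarith [sq_nonneg (κ * ‖y s‖ - (Wcount L s.1 : ℝ) * ‖Y s.1‖)]
    have e : (κ * (‖y s‖ ^ 2 / (Wcount L s.1 : ℝ)) + (Wcount L s.1 : ℝ) * ‖Y s.1‖ ^ 2 / κ) / 2
        = (κ ^ 2 * ‖y s‖ ^ 2 + (Wcount L s.1 : ℝ) ^ 2 * ‖Y s.1‖ ^ 2) / (2 * (κ * (Wcount L s.1 : ℝ))) := by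
      field_simp
    rw [e, le_div_iff₀ (by positivity)]
    linarith
  have hcs : q ≤ (κ * A + (∑ s : Ssub L, (Wcount L s.1 : ℝ) * ‖Y s.1‖ ^ 2) / κ) / 2 := by
    rw [hq1]
    refine le_trans (Saddle.re_dotProduct_le_sum_norm y _) ?_
    refine le_trans (Finset.sum_le_sum fun s _ => hpt s) ?_
    rw [← Finset.sum_div, Finset.sum_add_distrib, Finset.mul_sum, Finset.sum_div]
  have h4 : (∑ s : Ssub L, (Wcount L s.1 : ℝ) * ‖Y s.1‖ ^ 2) / κ ≤ q := by
    rw [div_le_iff₀ hκpos]; linarith [hmass]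
  linarith

/-- `Re⟨y, (ΔW)⁻¹ y⟩ = Σ_S |y_s|²/(ΔW_s)`. [folklore] -/
theorem re_diagW_form (Δ : ℝ) (y : Ssub L → ℂ) :
    (star y ⬝ᵥ diagW L Δ *ᵥ y).re = ∑ s : Ssub L, ‖y s‖ ^ 2 / (Δ * (Wcount L s.1 : ℝ)) := by
  unfold diagW
  simp only [dotProduct, Pi.star_apply, Complex.star_def, Matrix.mulVec_diagonal, Complex.re_sum]
  refine Finset.sum_congr rfl fun s _ => ?_
  rw [show (starRingEnd ℂ) (y s) * ((((1 / (Δ * (Wcount L s.1 : ℝ))) : ℝ) : ℂ) * y s)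
      = (((1 / (Δ * (Wcount L s.1 : ℝ))) : ℝ) : ℂ) * ((starRingEnd ℂ) (y s) * y s) by ring,
    Complex.re_ofReal_mul, Complex.conj_mul', show ((‖y s‖ : ℂ) ^ 2) = (((‖y s‖ ^ 2 : ℝ)) : ℂ) by push_cast; ring,
    Complex.ofReal_re]
  ring

/-- **ELEMENTARY SHELL COERCIVITY:** `(1 − Δκ_E)·Σ_S |y_s|²/(ΔW_s) ≤ Re⟨y, Q̃(T) y⟩` for `0 < Δ`, `0 ≤ ε₁ + T`, `T < 2ε₁`,
`L ≥ 4` — the shape of `L2Quant` with the constant `1 − Δκ_E` in place of `ĝ₀`. [folklore] -/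
theorem shell_coercive_elementary (hL : 4 ≤ L) {Δ : ℝ} (hΔ : 0 < Δ) {T : ℝ} (hE : 0 ≤ eps1 L + T) (hT : T < 2 * eps1 L)
    (y : Ssub L → ℂ) :
    (1 - Δ * (3 * eps1 L / (2 * eps1 L - T))) * ∑ s : Ssub L, ‖y s‖ ^ 2 / (Δ * (Wcount L s.1 : ℝ))
      ≤ (star y ⬝ᵥ Qtilde L T Δ *ᵥ y).re := by
  rw [Qtilde_eq, Matrix.sub_mulVec, dotProduct_sub, Complex.sub_re, re_diagW_form]
  have h := re_Rmat_le L hL hE hT y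
  have e : ∑ s : Ssub L, ‖y s‖ ^ 2 / (Wcount L s.1 : ℝ) = Δ * ∑ s : Ssub L, ‖y s‖ ^ 2 / (Δ * (Wcount L s.1 : ℝ)) := by
    rw [Finset.mul_sum]
    refine Finset.sum_congr rfl fun s _ => ?_
    have hW : (Wcount L s.1 : ℝ) ≠ 0 := by
      have := Wcount_pos_of_InS L s.2; exact_mod_cast (by omega : Wcount L s.1 ≠ 0)
    field_simp
  rw [e] at h
  nlinarith [h]

end Summit.HubbardSuperconductivity.HubbardSuperconductivity.Theorems.AnisotropyChord.Transfer.Fibre3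

end
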